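import Mathlib
import Summits.Langlands.Langlands.Theses.NonParallelVoid
import Literature.NumberTheory.GaloisRepresentations.PstCrystallineExtensionData
import Literature.NumberTheory.GaloisRepresentations.EnormousSubgroup
import Literature.NumberTheory.GaloisRepresentations.ProjectiveType
import Literature.NumberTheory.GaloisRepresentations.DecomposedGeneric
import Literature.NumberTheory.GaloisRepresentations.AbsGaloisGroup
import Literature.NumberTheory.Automorphic.Qian2022PotentialAutomorphy
import Literature.NumberTheory.GaloisRepresentations.AbsGaloisOuterConj
import Literature.NumberTheory.GaloisRepresentations.DecomposedGenericOfQuadratic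
import Literature.NumberTheory.GaloisRepresentations.ResidualRepRestrict
import Literature.NumberTheory.GaloisRepresentations.ResidualRepUnique
import Literature.NumberTheory.GaloisRepresentations.ResidualRepOfTraceCongruence
import Literature.NumberTheory.GaloisRepresentations.ResiduallyReducibleOfStableLine
import Literature.NumberTheory.GaloisRepresentations.StableLatticeValuationRing
import Literature.RingTheory.Valuation.AlgClosedResidue
import Summits.Langlands.Langlands.Theorems.RamifiedCoefficientSeedAdjointLiftingGL3StubAdjointResidualImageHelpers
import Summits.Langlands.Langlands.Theorems.NonParallelVoidTensorSquareParallelStubResidualIrreducibilityForm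
import Summits.Langlands.Langlands.Theorems.NonParallelVoidTensorSquareParallelStubResidualIrreducibilityTensorLine
import Summits.Langlands.Langlands.Theorems.NonParallelVoidTensorSquareParallelStubResidualIrreducibilityTensor
import Summits.Langlands.Langlands.Theorems.NonParallelVoidTensorSquareParallelStubResidualIrreducibilityTwist
import Summits.Langlands.Langlands.Theorems.NonParallelVoidTensorSquareParallelStubResidualIrreducibilityKronecker
import HarnessLib

/-!
# Stub `stub_residualIrreducibility` of line `merged` for crux `TensorSquareParallel` (stmt-Langlands-17009)

Calegari's tensor-induction line (Calegari 2010, §2 and §6): let `F` be imaginary quadratic,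
`p ≥ 11` split in `F`, `ρ : Γ_F → GL₂(ℚ̄_p)` with `ρ̄|_{Γ_{F(ζ_p)}}` absolutely irreducible, NOT
of base-change type (`¬hB`: no `τ ∈ Γ_ℚ ∖ Γ_F` and character `χ` of `Γ_F` with
`tr ρ̄(τστ⁻¹) = χ(σ) tr ρ̄(σ)`, `det ρ̄(τστ⁻¹) = χ(σ)² det ρ̄(σ)`) and NOT dihedral on `Γ_{F(ζ_p)}`
(`¬hD`: no character `η ≠ 1` of `Γ_{F(ζ_p)}` with `tr ρ̄ = η · tr ρ̄` there).  Then EVERY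
`ψ : Γ_ℚ → GL₄(ℚ̄_p)` whose traces on `Γ_F` are those of `ρ ⊗ ρ^θ` (`θ` the outer conjugation
of `Γ_F` by some `τ ∉ Γ_F`, hypothesis (T0)) is residually absolutely irreducible on
`Γ_{ℚ(ζ_p)}` — the residual hypothesis of BLGGT Thm. C for the tensor induction.

## Proof (registered skeleton `work/TensorSquareParallel.lean`, stub `stub_residualIrreducibility`)

All representation theory is CLASSIFICATION-FREE (no Dickson), in four helper files
(`…StubResidualIrreducibility{Form,TensorLine,Tensor,Twist,Kronecker}`):

* Step A (reductions and characteristic polynomials).  A reduction `ψ̄` of `ψ` (integral models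
  over `ℤ̄_p` exist, `exists_integralModel_of_valuationSubring`) and the reduction
  `T̄ = ρ̄₀ ⊗ ρ̄₀^θ` of `T = ρ ⊗ ρ^θ : Γ_F → GL₄(ℚ̄_p)` (`ρ₀` an integral model of `ρ`; Kronecker
  products commute with integral models and reductions, helper 4) have, on `Λ = Γ_{F(ζ_p)}`, the
  same characteristic polynomials: in characteristic `0`, `ψ|_{Γ_F}` and `T` have the same
  traces by (T0), hence the same characteristic polynomials (`charpoly_eq_of_trace_eq`:
  semisimplification + the characteristic-zero Brauer–Nesbitt theorem of the tree), and
  characteristic polynomials reduce.  So `ψ̄|_Λ` is absolutely irreducible as soon as `T̄|_Λ` is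
  (`isAbsIrreducible_of_charpoly_eq` of the `AdjointLiftingGL3` helpers: Brauer–Nesbitt over `𝔽̄_p`),
  and `Λ ↪ Γ_{ℚ(ζ_p)}` (`IsAbsIrreducible.of_range_le`).
* Step C (helpers 2a/2b, 4).  `T̄|_Λ = V ⊗ V'` with `V = ρ̄₀|_Λ` (absolutely irreducible: it has
  the residual characteristic polynomials of `ρ|_Λ`), `V' = ρ̄₀^θ|_Λ` (same image), is
  absolutely irreducible provided `V` is non-dihedral in trace form — this is `¬hD`, as `ρ̄₀` and
  the tree's `ρ.residualRep` have the same characteristic polynomials — and `V'` is not conjugate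
  to a twist of `V`:
* Step B (helper 3).  If `V' ≅ χ ⊗ V` on `Λ`, then (`¬hD` making `χ` `Γ_F`-invariant, Schur)
  `ρ̄₀^θ ≅ χ' ⊗ ρ̄₀` on `Γ_F`, which is the excluded base-change identity `hB`.

## References

* [Calegari2010] F. Calegari, *Even Galois representations and the Fontaine–Mazur conjecture*,
  Invent. Math. 185 (2011) 1–16 (arXiv:0907.3427), §2 (the tensor representation), §6.
* [BarnetlambEtAl2014] T. Barnet-Lamb, T. Gee, D. Geraghty, R. Taylor, *Potential automorphy
  and change of weight*, Ann. of Math. 179 (2014), Thm. C (residual irreducibility on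
  `Γ_{F(ζ_p)}` as hypothesis).
* [DarmonDiamondTaylor1995] H. Darmon, F. Diamond, R. Taylor, *Fermat's Last Theorem*, §2.1
  (reductions, Brauer–Nesbitt) — through `ResidualGaloisRep`.
-/

noncomputable section

set_option linter.dupNamespace false  -- `Summit.Langlands.Langlands.…` is the mandated summit-side namespace (D-0022)

open scoped NumberField MatrixGroups
open IsDedekindDomain Field Matrix
open Literature.NumberTheory.GaloisRepresentations Literature.NumberTheory.PAdicHodge
  Literature.NumberTheory.Automorphic

namespace Summit.Langlands.Langlands.Theorems.TensorSquareParallel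

/-! ## The stub -/

/-- **Residual absolute irreducibility of the tensor induction on `Γ_{ℚ(ζ_p)}`** (Calegari 2010,
§2, §6; the residual hypothesis of BLGGT Thm. C in crux `TensorSquareParallel`).  For `F`
imaginary quadratic, `p ≥ 11` split, `ρ : Γ_F → GL₂(ℚ̄_p)` with `ρ̄|_{Γ_{F(ζ_p)}}` absolutely
irreducible, not of base-change type and not dihedral on `Γ_{F(ζ_p)}` (trace forms), every
`ψ : Γ_ℚ → GL₄(ℚ̄_p)` with the traces of `ρ ⊗ ρ^θ` on `Γ_F` is residually absolutely irreducible
on `Γ_{ℚ(ζ_p)}`.  Proof: module docstring (Steps A, B, C; classification-free).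
[cite: Calegari2010, §2 and §6 (the tensor representation and its residual image)] -/
theorem stub_residualIrreducibility : ∀ (F : Type) [Field F] [NumberField F] [Algebra.IsQuadraticExtension ℚ F], NumberField.IsTotallyComplex F → ∀ (p : ℕ) [Fact p.Prime] (ρ : FramedGaloisRep F (PadicAlgCl p) 2), ρ.toGaloisRep.IsIrreducible → (∀ᶠ v : HeightOneSpectrum (𝓞 F) in Filter.cofinite, ρ.IsUnramifiedAt v) → (∀ (v : HeightOneSpectrum (𝓞 F)) (hv : ((p : ℕ) : 𝓞 F) ∈ v.asIdeal), (fontainePstAdicCompletion v p hv).IsDeRhamFramed (ρ.toLocal v) ∧ (letI := (fontainePstAdicCompletion v p hv).algebra; ∀ τ : v.adicCompletion F →ₐ[ℚ_[p]] PadicAlgCl p, ∃ a b : ℤ, a < b ∧ ρ.labelledHodgeTateWeightsAt v (fontainePstAdicCompletion v p hv).algebra (fontainePstAdicCompletion v p hv).𝔅 τ.toRingHom = {a, b})) → (11 ≤ p ∧ (∃ v w : HeightOneSpectrum (𝓞 F), v ≠ w ∧ ((p : ℕ) : 𝓞 F) ∈ v.asIdeal ∧ ((p : ℕ) : 𝓞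 F) ∈ w.asIdeal) ∧ (∀ (v : HeightOneSpectrum (𝓞 F)) (hv : ((p : ℕ) : 𝓞 F) ∈ v.asIdeal), (fontainePstAdicCompletion v p hv).IsCrystallineFramed (ρ.toLocal v)) ∧ FramedGaloisRep.IsResiduallyAbsIrreducible (ρ.restrictField (CyclotomicField p F))) → ¬ (∃ τ : absoluteGaloisGroup ℚ, τ ∉ Set.range (absGaloisRestrict ℚ F) ∧ ∃ χ : absoluteGaloisGroup F →* (padicAlgClResidueField p)ˣ, ∀ σ σ' : absoluteGaloisGroup F, absGaloisRestrict ℚ F σ' = τ * absGaloisRestrict ℚ F σ * τ⁻¹ → (ρ.residualRep σ').val.trace = (χ σ : padicAlgClResidueField p) * (ρ.residualRep σ).val.trace ∧ (ρ.residualRep σ').val.det = (χ σ : padicAlgClResidueField p) ^ 2 * (ρ.residualRep σ).val.det) → ¬ (∃ η : absoluteGaloisGroup (CyclotomicField p F) →* (padicAlgClResidueField p)ˣ, η ≠ 1 ∧ ∀ σ : absoluteGaloisGroup (CyclotomicField p F), (ρ.residualRep (absGaloisRestrict F (CyclotomicField p F) σ)).val.trace = (η σ : padicAlgClResidueField p)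 * (ρ.residualRep (absGaloisRestrict F (CyclotomicField p F) σ)).val.trace) → ∀ ψ : FramedGaloisRep ℚ (PadicAlgCl p) 4, (∀ τ : absoluteGaloisGroup ℚ, τ ∉ Set.range (absGaloisRestrict ℚ F) → ∀ σ σ' : absoluteGaloisGroup F, absGaloisRestrict ℚ F σ' = τ * absGaloisRestrict ℚ F σ * τ⁻¹ → (ψ (absGaloisRestrict ℚ F σ)).val.trace = (ρ σ).val.trace * (ρ σ').val.trace) → FramedGaloisRep.IsResiduallyAbsIrreducible (ψ.restrictField (CyclotomicField p ℚ)) := by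
  intro F _ _ _ _hF p _ ρ _hirr _hunr _hdR hG hB hD ψ hT0
  obtain ⟨hp11, -, -, hres⟩ := hG
  have hp : p.Prime := Fact.out
  -- the residue field `k = ℤ̄_p/𝔪`
  haveI : IsAlgClosed (padicAlgClResidueField p) :=
    Literature.RingTheory.Valuation.isAlgClosed_residueField (padicAlgClIntegers p)
  haveI : CharP (padicAlgClResidueField p) p := charP_padicAlgClResidueField p
  have h2 : (2 : padicAlgClResidueField p) ≠ 0 :=
    (two_ne_zero_and_three_ne_zero_of_charP (k := padicAlgClResidueField p) (by omega)).1
  -- instances on the fields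
  haveI : NeZero ((p : ℕ) : F) := ⟨Nat.cast_ne_zero.mpr hp.ne_zero⟩
  haveI : NeZero ((p : ℕ) : ℚ) := ⟨Nat.cast_ne_zero.mpr hp.ne_zero⟩
  haveI : IsCyclotomicExtension {p} F (CyclotomicField p F) :=
    CyclotomicField.isCyclotomicExtension p F
  haveI : IsCyclotomicExtension {p} ℚ (CyclotomicField p ℚ) :=
    CyclotomicField.isCyclotomicExtension p ℚ
  haveI : IsGalois F (CyclotomicField p F) := IsCyclotomicExtension.isGalois {p} F _
  haveI : IsGalois ℚ F := Algebra.IsQuadraticExtension.isGalois ℚ F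
  -- notation
  set k := padicAlgClResidueField p with hk
  set G := absoluteGaloisGroup F with hGdef
  set Λ := absoluteGaloisGroup (CyclotomicField p F) with hΛ
  set r : G →* absoluteGaloisGroup ℚ := (absGaloisRestrict ℚ F).toMonoidHom with hr
  set rF : Λ →* G := (absGaloisRestrict F (CyclotomicField p F)).toMonoidHom with hrF
  set rL : absoluteGaloisGroup (CyclotomicField p ℚ) →* absoluteGaloisGroup ℚ :=
    (absGaloisRestrict ℚ (CyclotomicField p ℚ)).toMonoidHom with hrL
  have hr_apply : ∀ σ, r σ = absGaloisRestrict ℚ F σ := fun _ => rfl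
  have hrF_apply : ∀ x, rF x = absGaloisRestrict F (CyclotomicField p F) x := fun _ => rfl
  /- Step 0: an element `τ ∈ Γ_ℚ ∖ Γ_F` and the outer conjugation `θ = θ_τ` of `Γ_F`. -/
  obtain ⟨τ, hτ⟩ : ∃ τ : absoluteGaloisGroup ℚ, τ ∉ Set.range (absGaloisRestrict ℚ F) := by
    have hcard : Nat.card (F ≃ₐ[ℚ] F) = 2 := by
      rw [IsGalois.card_aut_eq_finrank, Algebra.IsQuadraticExtension.finrank_eq_two]
    haveI : Nontrivial (F ≃ₐ[ℚ] F) := by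
      rw [← Finite.one_lt_card_iff_nontrivial, hcard]; norm_num
    obtain ⟨g, hg⟩ := exists_ne (1 : F ≃ₐ[ℚ] F)
    obtain ⟨τ, rfl⟩ := absGaloisQuot_surjective ℚ F g
    refine ⟨τ, fun hmem => hg ?_⟩
    rw [absGaloisQuot_eq_one_iff]
    obtain ⟨σ, hσ⟩ := hmem
    exact ⟨σ, hσ⟩
  set θ : G →* G := (absGaloisOuterConj ℚ F τ).toMonoidHom with hθ
  have hθ_apply : ∀ σ, θ σ = absGaloisOuterConj ℚ F τ σ := fun _ => rfl
  have hrθ : ∀ σ : G, absGaloisRestrict ℚ F (θ σ) = τ * absGaloisRestrict ℚ F σ * τ⁻¹ :=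
    fun σ => absGaloisRestrict_absGaloisOuterConj ℚ F τ σ
  -- (T0) along `θ`: `tr ψ(res σ) = tr ρ(σ) · tr ρ(θ σ)`
  have hT0' : ∀ σ : G, (ψ (r σ)).val.trace = (ρ σ).val.trace * (ρ (θ σ)).val.trace :=
    fun σ => hT0 τ hτ σ (θ σ) (hrθ σ)
  /- Step 1: integral models and reductions of `ψ`, `ρ`, and of `T = ρ ⊗ ρ^θ`. -/
  obtain ⟨Pψ, ψ₀, hPψ⟩ := exists_integralModel_of_valuationSubring (O := padicAlgClIntegers p)
    (Valued.isOpen_valuationSubring (PadicAlgCl p)) ψ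
  set ψb : absoluteGaloisGroup ℚ →* GL (Fin 4) k := integralReduction (RingHom.id _) ψ₀ with hψb
  have hψmodel : IsIntegralModelOf (ψ : absoluteGaloisGroup ℚ →* GL (Fin 4) (PadicAlgCl p)) ψ₀ :=
    ⟨Pψ, fun g => hPψ g⟩
  have hψred : ψ.IsReductionOf (RingHom.id _) ψb :=
    ⟨ψ₀, 1, hψmodel, fun g => by rw [inv_one, one_mul, mul_one]⟩
  obtain ⟨Pρ, ρ₀, hPρ⟩ := exists_integralModel_of_valuationSubring (O := padicAlgClIntegers p)
    (Valued.isOpen_valuationSubring (PadicAlgCl p)) ρ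
  have hρmodel : IsIntegralModelOf (ρ : G →* GL (Fin 2) (PadicAlgCl p)) ρ₀ := ⟨Pρ, fun g => hPρ g⟩
  set ρb : G →* GL (Fin 2) k := integralReduction (RingHom.id _) ρ₀ with hρb
  have hρred : ρ.IsReductionOf (RingHom.id _) ρb :=
    ⟨ρ₀, 1, hρmodel, fun g => by rw [inv_one, one_mul, mul_one]⟩
  -- the Kronecker products `T = ρ ⊗ ρ^θ`, `Tb = ρ̄₀ ⊗ ρ̄₀^θ`
  obtain ⟨T, hT⟩ := exists_kroneckerHom (ρ : G →* GL (Fin 2) (PadicAlgCl p))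
    ((ρ : G →* GL (Fin 2) (PadicAlgCl p)).comp θ)
  obtain ⟨Tb, hTb⟩ := exists_kroneckerHom ρb (ρb.comp θ)
  have hTred : IsReductionOf (O := padicAlgClIntegers p) (RingHom.id k) T Tb :=
    isReductionOf_kronecker (RingHom.id k) hρmodel (hρmodel.comp θ) hT (fun g => by
      rw [hTb]; rfl)
  /- Step 2 (characteristic 0): `ψ ∘ res` and `T` have the same characteristic polynomials. -/
  have hcp0 : ∀ σ : G, ((ψ (r σ) : GL (Fin 4) (PadicAlgCl p)) :
      Matrix (Fin 4) (Fin 4) (PadicAlgCl p)).charpoly =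
      ((T σ : GL (Fin (2 * 2)) (PadicAlgCl p)) : Matrix (Fin (2 * 2)) (Fin (2 * 2)) (PadicAlgCl p)).charpoly := by
    refine charpoly_eq_of_trace_eq
      (((ψ : absoluteGaloisGroup ℚ →* GL (Fin 4) (PadicAlgCl p)).comp r) : G →* GL (Fin (2 * 2)) (PadicAlgCl p))
      T (fun σ => ?_)
    rw [hT σ, trace_glKronecker]
    exact hT0' σ
  /- Step 3 (reduction): on `Λ = Γ_{F(ζ_p)}`, `ψ̄ ∘ res ∘ res_F` and `Tb ∘ res_F` have the same
    characteristic polynomials. -/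
  have hψcp : HasResidualCharpolys (O := padicAlgClIntegers p) (RingHom.id k)
      ((T.comp rF : Λ →* GL (Fin (2 * 2)) (PadicAlgCl p)))
      (((ψb.comp (r.comp rF)) : Λ →* GL (Fin 4) k) : Λ →* GL (Fin (2 * 2)) k) := by
    intro x
    obtain ⟨P, hP1, hP2⟩ := (hψred.hasResidualCharpolys.comp (r.comp rF)) x
    refine ⟨P, hP1.trans ?_, hP2⟩
    exact hcp0 (rF x)
  have hTcp : HasResidualCharpolys (O := padicAlgClIntegers p) (RingHom.id k) (T.comp rF) (Tb.comp rF) :=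
    hTred.hasResidualCharpolys.comp rF
  have hcp : ∀ x : Λ, ((((ψb.comp (r.comp rF)) : Λ →* GL (Fin 4) k) : Λ →* GL (Fin (2 * 2)) k) x :
      Matrix (Fin (2 * 2)) (Fin (2 * 2)) k).charpoly =
      ((Tb.comp rF x : GL (Fin (2 * 2)) k) : Matrix (Fin (2 * 2)) (Fin (2 * 2)) k).charpoly :=
    fun x => hψcp.charpoly_eq hTcp x
  /- Step 4: the hypotheses of the tensor criterion for `V = ρ̄₀|_Λ`, `V' = ρ̄₀^θ|_Λ`. -/
  set V : Λ →* GL (Fin 2) k := ρb.comp rF with hV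
  set V' : Λ →* GL (Fin 2) k := (ρb.comp θ).comp rF with hV'
  have hTbV : ∀ x, Tb.comp rF x = glKronecker (V x) (V' x) := fun x => by
    rw [MonoidHom.comp_apply, hTb]; rfl
  -- (a) `V` is absolutely irreducible: it has the residual characteristic polynomials of `ρ|_Λ`
  have hVabs : IsAbsIrreducible V := by
    obtain ⟨τ₀, hτ₀, hτ₀abs⟩ := hres
    have hVred : (ρ.restrictField (CyclotomicField p F)).IsReductionOf (RingHom.id _) V :=
      FramedGaloisRep.isReductionOf_restrictField hρred _
    exact Summit.Langlands.Langlands.Cruxes.AdjointLiftingGL3.Birth.isAbsIrreducible_of_charpoly_eq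
      (fun x => hVred.hasResidualCharpolys.charpoly_eq hτ₀.hasResidualCharpolys x) hτ₀abs
  have hVeig : ∀ v : Fin 2 → k, v ≠ 0 → ∃ x, ((V x : GL (Fin 2) k) : Matrix (Fin 2) (Fin 2) k) *ᵥ v ∉ k ∙ v :=
    exists_not_mem_span_of_isIrreducible V hVabs.isIrreducible
  -- (b) `V'` has the same image as `V` (`θ` preserves `Γ_{F(ζ_p)} = res_F(Λ)`)
  have hrange_rF : rF.range = absGaloisGroupAdjoinRootsOfUnity F p := by
    rw [hrF]
    exact range_absGaloisRestrict_eq_absGaloisGroupAdjoinRootsOfUnity F (CyclotomicField p F) p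
  have hθmem : ∀ (c : absoluteGaloisGroup ℚ) (g : G), g ∈ absGaloisGroupAdjoinRootsOfUnity F p →
      absGaloisOuterConj ℚ F c g ∈ absGaloisGroupAdjoinRootsOfUnity F p := fun c g hg => by
    rw [← map_absGaloisOuterConj_absGaloisGroupAdjoinRootsOfUnity ℚ F p c]
    exact Subgroup.mem_map_of_mem _ hg
  have hV'eig : ∀ v : Fin 2 → k, v ≠ 0 → ∃ x, ((V' x : GL (Fin 2) k) : Matrix (Fin 2) (Fin 2) k) *ᵥ v ∉ k ∙ v := by
    refine exists_not_mem_span_of_range_le hVeig ?_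
    rintro _ ⟨x, rfl⟩
    -- `rF x = θ (rF y)` for some `y`
    have hx : rF x ∈ absGaloisGroupAdjoinRootsOfUnity F p := hrange_rF ▸ ⟨x, rfl⟩
    have hy := hθmem τ⁻¹ (rF x) hx
    rw [← hrange_rF] at hy
    obtain ⟨y, hy⟩ := hy
    refine ⟨y, ?_⟩
    simp only [hV, hV', MonoidHom.comp_apply, hθ_apply]
    rw [hy, absGaloisOuterConj_apply_inv_apply]
  -- (c) traces and determinants of `ρ̄₀` are those of the tree's `ρ.residualRep`
  have hρbcp : ∀ g : G, ((ρb g : GL (Fin 2) k) : Matrix (Fin 2) (Fin 2) k).charpoly =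
      ((ρ.residualRep g : GL (Fin 2) k) : Matrix (Fin 2) (Fin 2) k).charpoly := fun g =>
    hρred.hasResidualCharpolys.charpoly_eq
      (FramedGaloisRep.isResidualRepOf_residualRep_fin_two ρ).hasResidualCharpolys g
  have htr : ∀ g : G, ((ρb g : GL (Fin 2) k) : Matrix (Fin 2) (Fin 2) k).trace =
      (ρ.residualRep g).val.trace := fun g => by
    rw [Matrix.trace_eq_neg_charpoly_nextCoeff, Matrix.trace_eq_neg_charpoly_nextCoeff, hρbcp g]
  have hdet : ∀ g : G, ((ρb g : GL (Fin 2) k) : Matrix (Fin 2) (Fin 2) k).det =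
      (ρ.residualRep g).val.det := fun g => by
    rw [Matrix.det_eq_sign_charpoly_coeff, Matrix.det_eq_sign_charpoly_coeff, hρbcp g]
  -- (d) `V` is non-dihedral in trace form: this is `¬hD`
  have hi : ¬ ∃ η : Λ →* kˣ, η ≠ 1 ∧ ∀ x, ((V x : GL (Fin 2) k) : Matrix (Fin 2) (Fin 2) k).trace =
      (η x : k) * ((V x : GL (Fin 2) k) : Matrix (Fin 2) (Fin 2) k).trace := by
    rintro ⟨η, hη, hηtr⟩
    refine hD ⟨η, hη, fun x => ?_⟩
    have := hηtr x
    simp only [hV, MonoidHom.comp_apply, htr, hrF_apply] at this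
    exact this
  -- (e) the outer action of `Γ_F` on `Λ` along `res_F`
  have hκ : ∀ g : G, ∃ κ : Λ →* Λ, ∀ x, rF (κ x) = g⁻¹ * rF x * g := fun g =>
    ⟨(absGaloisOuterConj F (CyclotomicField p F) g⁻¹).toMonoidHom, fun x => by
      rw [hrF_apply, hrF_apply]
      change absGaloisRestrict F (CyclotomicField p F) (absGaloisOuterConj F (CyclotomicField p F) g⁻¹ x) = _
      rw [absGaloisRestrict_absGaloisOuterConj, inv_inv]⟩
  -- (f) `V'` is not conjugate to a twist of `V`: otherwise `ρ̄` would be of base-change type (`hB`)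
  have hii : ¬ ∃ (χ : Λ →* kˣ) (P : GL (Fin 2) k), ∀ x,
      ((V' x : GL (Fin 2) k) : Matrix (Fin 2) (Fin 2) k) =
        (χ x : k) • (((P * V x * P⁻¹ : GL (Fin 2) k)) : Matrix (Fin 2) (Fin 2) k) := by
    rintro ⟨χ, P, hχ⟩
    obtain ⟨χ', P', hχ'⟩ := stub_residualIrreducibility_twist k G Λ rF θ ρb hκ hVeig hi
      ⟨χ, P, fun x => by simpa only [hV, hV', MonoidHom.comp_apply] using hχ x⟩
    refine hB ⟨τ, hτ, χ', fun σ σ' hσ' => ?_⟩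
    have hσ'θ : σ' = θ σ := absGaloisRestrict_injective ℚ F (hσ'.trans (hrθ σ).symm)
    subst hσ'θ
    have e := hχ' σ
    constructor
    · rw [← htr, ← htr, e, trace_smul_units_conj]
    · rw [← hdet, ← hdet, e, Matrix.det_smul, Units.val_mul, Units.val_mul, Matrix.det_units_conj,
        Fintype.card_fin]
  /- Step 5: `Tb|_Λ = V ⊗ V'` is absolutely irreducible (tensor criterion), hence so is `ψ̄|_Λ`. -/
  have hTbabs : IsAbsIrreducible (Tb.comp rF) :=
    stub_residualIrreducibility_kronecker k Λ V V' (Tb.comp rF) hTbV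
      (stub_residualIrreducibility_tensor k h2 Λ V V' hVeig hV'eig hi hii)
  have hψΛ : IsAbsIrreducible (((ψb.comp (r.comp rF)) : Λ →* GL (Fin 4) k) : Λ →* GL (Fin (2 * 2)) k) :=
    Summit.Langlands.Langlands.Cruxes.AdjointLiftingGL3.Birth.isAbsIrreducible_of_charpoly_eq hcp hTbabs
  have hψΛ' : IsAbsIrreducible (ψb.comp (r.comp rF)) := hψΛ
  /- Step 6: `res(res_F(Λ)) ⊆ res_L(Γ_{ℚ(ζ_p)})`, so `ψ̄ ∘ res_L` is absolutely irreducible. -/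
  have hψL : IsAbsIrreducible (ψb.comp rL) := by
    refine Summit.Langlands.Langlands.Cruxes.AdjointLiftingGL3.Birth.IsAbsIrreducible.of_range_le hψΛ' ?_
    rintro _ ⟨x, rfl⟩
    have hx : rF x ∈ absGaloisGroupAdjoinRootsOfUnity F p := hrange_rF ▸ ⟨x, rfl⟩
    have hx' : r (rF x) ∈ absGaloisGroupAdjoinRootsOfUnity ℚ p :=
      (mem_absGaloisGroupAdjoinRootsOfUnity_iff_absGaloisRestrict ℚ F p (rF x)).mp hx
    rw [← range_absGaloisRestrict_eq_absGaloisGroupAdjoinRootsOfUnity ℚ (CyclotomicField p ℚ) p] at hx'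
    obtain ⟨y, hy⟩ := hx'
    refine ⟨y, ?_⟩
    simp only [MonoidHom.comp_apply]
    exact congrArg ψb hy
  /- Conclusion. -/
  exact ⟨ψb.comp rL, FramedGaloisRep.isReductionOf_restrictField hψred _, hψL⟩

end Summit.Langlands.Langlands.Theorems.TensorSquareParallel

end
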